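import Mathlib.Data.Vector.Basic
import Mathlib.Data.Fintype.BigOperators
import Mathlib.Algebra.BigOperators.Fin
import Literature.Computability.AlgebraicComplexity.AutomatonIMM
import Literature.Computability.AlgebraicComplexity.UnbiasedWords
import Literature.Computability.AlgebraicComplexity.SetMultilinear
import HarnessLib

/-!
# The word polynomial `P_w` of Limaye–Srinivasan–Tavenas as a projection of `IMM`

(N. Limaye, S. Srinivasan, S. Tavenas, J. ACM 72 (2025), Art. 26 = FOCS 2021, §2.2 (the word
polynomial `P_w`), §8, Lemma 22 (a width-`2^b` set-multilinear ABP for `P_w`) and the proof of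
Lemma 8 (`P_w` is a set-multilinear restriction of `IMM_{2^b, d}`).)

Fix a word by its sign pattern `pos : Fin d → Bool` and `k` (`UnbiasedWords.lean`): block `i`
has the `2^{|w_i|}` variables `X i = (Fin (letterSize k pos i) → Bool)`, labelled by bit-strings
of length `|w_i|`. An assignment `w : Π i, X i` of one variable per block determines the
*positive stream* `σ(m⁺)` (concatenation of the labels of the positive blocks, in order) and the
*negative stream* `σ(m⁻)`; the monomial is in `P_w` iff the two streams are *compatible*
(`Compat`: the shorter is a prefix of the longer, LST's `σ(m⁺) ∼ σ(m⁻)`), and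
`wordPoly k pos = ∑_{compatible w} ∏_i X ⟨i, w i⟩` is LST's `P_w` (p. 26:9).

## Content (all proved)

* `stream`, `streamLen`, `Compat` and its calculus under appending a block
  (`compat_append_iff_of_le`, `compat_append_iff_of_lt`), the *overhang* and its update;
* the **queue automaton** of LST's Lemma 22 (`wordStep`: push the new label onto the overhang if
  the block is on the longer side, otherwise compare it with the oldest overhang bits), with
  states `List.Vector Bool (overLen k pos t)` at layer `t`, and its correctness
  `run_wordStep` / `accepts_wordStep_iff`: a word is accepted iff its streams are compatible;
* `overLen_le`: for a `k`-unbiased word the overhang never exceeds `k` bits, so the states embed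
  into `Fin n` as soon as `2^k ≤ n` (`wordEnc`, `wordEnc_injective`);
* **`aeval_wordSubst_immPoly`**: the block-preserving substitution `wordSubst` turns
  `immPoly n d K` into `wordPoly k pos` (`AutomatonIMM.aeval_autSubst_immPoly`), and
  `isBlockPreserving_wordSubst`.

The rank of `M_w(P_w)` is computed in the sequel file. Everything lives in the sub-namespace
`Literature.Computability.AlgebraicComplexity.LSTWord`, like `UnbiasedWords.lean`.

## References

* N. Limaye, S. Srinivasan, S. Tavenas, J. ACM 72 (2025), Art. 26, §2.2 (p. 26:9), Lemma 22 and
  proof of Lemma 8 (pp. 26:20–26:21).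
-/

noncomputable section

open MvPolynomial

namespace Literature.Computability.AlgebraicComplexity

namespace LSTWord

/-! ### Compatibility of bit-strings -/

section Compat

/-- Two bit-strings are *compatible* if the shorter one is a prefix of the other (LST 2025,
§2.2: "we will write `σ(m⁺) ∼ σ(m⁻)` when the shorter one is a prefix of the other one").
[cite: LimayeSrinivasanTavenas2025, §2.2] -/
def Compat (l₁ l₂ : List Bool) : Prop := l₁ <+: l₂ ∨ l₂ <+: l₁

/-- Compatibility is decidable. [folklore] -/
instance (l₁ l₂ : List Bool) : Decidable (Compat l₁ l₂) := by unfold Compat; infer_instance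

/-- Compatibility is symmetric. [cite: LimayeSrinivasanTavenas2025, §2.2] -/
theorem Compat.symm {l₁ l₂ : List Bool} (h : Compat l₁ l₂) : Compat l₂ l₁ := Or.symm h

/-- Compatibility is symmetric (iff form). [cite: LimayeSrinivasanTavenas2025, §2.2] -/
theorem compat_comm (l₁ l₂ : List Bool) : Compat l₁ l₂ ↔ Compat l₂ l₁ := ⟨Compat.symm, Compat.symm⟩

/-- A prefix of an extension that is no longer than the original is a prefix of the original.
[folklore] -/
theorem prefix_of_prefix_append {q p b : List Bool} (h : q <+: p ++ b) (hl : q.length ≤ p.length) :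
    q <+: p := by
  rw [List.prefix_iff_eq_take] at h
  rw [List.take_append_of_le_length hl] at h
  rw [h]
  exact List.take_prefix _ _

/-- For strings of comparable length, compatibility is being a prefix. [folklore] -/
theorem compat_iff_prefix_of_le {p q : List Bool} (h : q.length ≤ p.length) :
    Compat p q ↔ q <+: p := by
  constructor
  · rintro (h1 | h1)
    · rw [h1.eq_of_length_le h]
    · exact h1
  · exact Or.inr

/-- Compatibility is preserved by shortening one string: `Compat (p ++ b) q → Compat p q`.
[cite: LimayeSrinivasanTavenas2025, Lemma 22] -/
theorem Compat.of_append_left {p b q : List Bool} (h : Compat (p ++ b) q) : Compat p q := by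
  rcases h with h | h
  · exact Or.inl ((List.prefix_append p b).trans h)
  · by_cases hl : q.length ≤ p.length
    · exact Or.inr (prefix_of_prefix_append h hl)
    · left
      rw [List.prefix_iff_eq_take] at h ⊢
      conv_rhs => rw [h]
      rw [List.take_take, min_eq_left (by omega), List.take_left']
      rfl

/-- **Appending to the longer (or equal) side keeps compatibility** (the "push" case of the
queue automaton, LST 2025, Lemma 22, cases `|w_{[i+1]}| ≥ |w_{[i]}|` with equal signs).
[cite: LimayeSrinivasanTavenas2025, Lemma 22] -/
theorem compat_append_iff_of_le {p q : List Bool} (h : q.length ≤ p.length) (b : List Bool) :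
    Compat (p ++ b) q ↔ Compat p q := by
  refine ⟨Compat.of_append_left, fun hc => ?_⟩
  rw [compat_iff_prefix_of_le h] at hc
  exact Or.inr (hc.trans (List.prefix_append p b))

/-- In the push case the overhang grows by the new label:
`(p ++ b).drop |q| = p.drop |q| ++ b`. [cite: LimayeSrinivasanTavenas2025, Lemma 22] -/
theorem drop_append_of_le {p : List Bool} {m : ℕ} (h : m ≤ p.length) (b : List Bool) :
    (p ++ b).drop m = p.drop m ++ b :=
  List.drop_append_of_le_length h

/-- **Appending to the shorter side**: if `p` is a proper prefix side (`|p| < |q|`) and `p, q`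
are compatible, then `Compat (p ++ b) q ↔ Compat b (q.drop |p|)` — the new label is compared
with the overhang (LST 2025, Lemma 22, the cases with opposite signs).
[cite: LimayeSrinivasanTavenas2025, Lemma 22] -/
theorem compat_append_iff_of_lt {p q : List Bool} (h : p.length < q.length) (hc : Compat p q)
    (b : List Bool) : Compat (p ++ b) q ↔ Compat b (q.drop p.length) := by
  have hp : p <+: q := by
    rw [compat_comm, compat_iff_prefix_of_le h.le] at hc
    exact hc
  have hq : q = p ++ q.drop p.length := (List.prefix_iff_eq_append.1 hp).symm
  constructor
  · intro h'
    rw [hq] at h'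
    rcases h' with h' | h'
    · exact Or.inl ((List.prefix_append_right_inj p).1 h')
    · exact Or.inr ((List.prefix_append_right_inj p).1 h')
  · intro h'
    conv_rhs => rw [hq]
    rcases h' with h' | h'
    · exact Or.inl ((List.prefix_append_right_inj p).2 h')
    · exact Or.inr ((List.prefix_append_right_inj p).2 h')

end Compat

/-! ### Streams of a word and an assignment -/

section Streams

variable {d : ℕ} (k : ℕ) (pos : Fin d → Bool)

/-- The block variables: block `i` is labelled by the bit-strings of length `|w_i|`
(LST 2025, §2.2: "we assume that the variables of `X_i` are labelled by strings in
`{0,1}^{|w_i|}`"). [cite: LimayeSrinivasanTavenas2025, §2.2] -/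
abbrev BlockVar (i : Fin d) : Type := Fin (letterSize k pos i) → Bool

/-- The stream of sign `sgn` after the first `t` blocks of the assignment `w`: the concatenation
of the labels of the blocks `i < t` with `pos i = sgn` (LST 2025, §2.2, `σ(m⁺)` and `σ(m⁻)`).
[cite: LimayeSrinivasanTavenas2025, §2.2] -/
def stream (sgn : Bool) (w : (i : Fin d) → BlockVar k pos i) : ℕ → List Bool
  | 0 => []
  | t + 1 => stream sgn w t ++
      (if h : t < d then (if pos ⟨t, h⟩ = sgn then List.ofFn (w ⟨t, h⟩) else []) else [])

/-- The length of the stream of sign `sgn` after `t` blocks (independent of the assignment).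
[cite: LimayeSrinivasanTavenas2025, §2.2] -/
def streamLen (sgn : Bool) : ℕ → ℕ
  | 0 => 0
  | t + 1 => streamLen sgn t +
      (if h : t < d then (if pos ⟨t, h⟩ = sgn then letterSize k pos ⟨t, h⟩ else 0) else 0)

/-- The stream after `t` blocks has length `streamLen`. [cite: LimayeSrinivasanTavenas2025, §2.2] -/
@[simp]
theorem length_stream (sgn : Bool) (w : (i : Fin d) → BlockVar k pos i) (t : ℕ) :
    (stream k pos sgn w t).length = streamLen k pos sgn t := by
  induction t with
  | zero => rfl
  | succ t ih =>
    simp only [stream, streamLen, List.length_append, ih]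
    split_ifs <;> simp

/-- The stream of sign `sgn` only reads the blocks of that sign below `t`.
[cite: LimayeSrinivasanTavenas2025, §2.2] -/
theorem stream_congr (sgn : Bool) {w w' : (i : Fin d) → BlockVar k pos i} (t : ℕ)
    (h : ∀ i : Fin d, (i : ℕ) < t → pos i = sgn → w i = w' i) :
    stream k pos sgn w t = stream k pos sgn w' t := by
  induction t with
  | zero => rfl
  | succ t ih =>
    simp only [stream]
    rw [ih fun i hi hs => h i (Nat.lt_succ_of_lt hi) hs]
    by_cases ht : t < d
    · simp only [dif_pos ht]
      by_cases hs : pos ⟨t, ht⟩ = sgn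
      · rw [if_pos hs, if_pos hs, h ⟨t, ht⟩ (Nat.lt_succ_self t) hs]
      · rw [if_neg hs, if_neg hs]
    · simp only [dif_neg ht]

/-- Unfolding the stream one block further, inside the range.
[cite: LimayeSrinivasanTavenas2025, §2.2] -/
theorem stream_succ (sgn : Bool) (w : (i : Fin d) → BlockVar k pos i) {t : ℕ} (ht : t < d) :
    stream k pos sgn w (t + 1) = stream k pos sgn w t ++
      (if pos ⟨t, ht⟩ = sgn then List.ofFn (w ⟨t, ht⟩) else []) := by
  simp only [stream, dif_pos ht]

/-- Unfolding the stream length one block further, inside the range.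
[cite: LimayeSrinivasanTavenas2025, §2.2] -/
theorem streamLen_succ (sgn : Bool) {t : ℕ} (ht : t < d) :
    streamLen k pos sgn (t + 1) = streamLen k pos sgn t +
      (if pos ⟨t, ht⟩ = sgn then letterSize k pos ⟨t, ht⟩ else 0) := by
  simp only [streamLen, dif_pos ht]

/-- The difference of the stream lengths is the prefix sum `w_{[t]}` of the word.
[cite: LimayeSrinivasanTavenas2025, §2.2] -/
theorem streamLen_sub_streamLen (t : ℕ) (ht : t ≤ d) :
    (streamLen k pos true t : ℤ) - streamLen k pos false t =
      wsum k pos (Finset.univ.filter fun i : Fin d => (i : ℕ) < t) := by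
  induction t with
  | zero => simp [streamLen, wsum]
  | succ t ih =>
    have ht' : t < d := Nat.lt_of_succ_le ht
    have hsplit : (Finset.univ.filter fun i : Fin d => (i : ℕ) < t + 1) =
        insert ⟨t, ht'⟩ (Finset.univ.filter fun i : Fin d => (i : ℕ) < t) := by
      ext i
      simp only [Finset.mem_filter, Finset.mem_univ, true_and, Finset.mem_insert, Fin.ext_iff]
      omega
    have hnot : (⟨t, ht'⟩ : Fin d) ∉ (Finset.univ.filter fun i : Fin d => (i : ℕ) < t) := by
      simp
    rw [wsum, hsplit, Finset.sum_insert hnot, ← wsum, ← ih ht'.le, streamLen_succ k pos _ ht',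
      streamLen_succ k pos _ ht', wt_eq]
    cases pos ⟨t, ht'⟩ <;> simp <;> ring

/-- **Validity** after `t` blocks: the two streams are compatible.
[cite: LimayeSrinivasanTavenas2025, §2.2] -/
def Valid (w : (i : Fin d) → BlockVar k pos i) (t : ℕ) : Prop :=
  Compat (stream k pos true w t) (stream k pos false w t)

/-- Validity is decidable. [folklore] -/
instance (w : (i : Fin d) → BlockVar k pos i) (t : ℕ) : Decidable (Valid k pos w t) := by
  unfold Valid; infer_instance

/-- Validity in terms of any sign and its opposite. [cite: LimayeSrinivasanTavenas2025, §2.2] -/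
theorem valid_iff (sgn : Bool) (w : (i : Fin d) → BlockVar k pos i) (t : ℕ) :
    Valid k pos w t ↔ Compat (stream k pos sgn w t) (stream k pos (!sgn) w t) := by
  unfold Valid
  cases sgn
  · exact compat_comm _ _
  · exact Iff.rfl

/-- The *overhang length* after `t` blocks: `|w_{[t]}|`, the absolute difference of the stream
lengths (LST 2025, Lemma 22: "at each layer the ABP has exactly `2^{|w_{[i]}|}` vertices").
[cite: LimayeSrinivasanTavenas2025, Lemma 22] -/
def overLen (t : ℕ) : ℕ :=
  (streamLen k pos true t - streamLen k pos false t) +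
    (streamLen k pos false t - streamLen k pos true t)

/-- The overhang length in terms of any sign and its opposite.
[cite: LimayeSrinivasanTavenas2025, Lemma 22] -/
theorem overLen_eq (sgn : Bool) (t : ℕ) :
    overLen k pos t = (streamLen k pos sgn t - streamLen k pos (!sgn) t) +
      (streamLen k pos (!sgn) t - streamLen k pos sgn t) := by
  unfold overLen
  cases sgn
  · simp only [Bool.not_false]; omega
  · simp only [Bool.not_true]

/-- The overhang length is the absolute value of the prefix sum `w_{[t]}`.
[cite: LimayeSrinivasanTavenas2025, Lemma 22] -/
theorem overLen_eq_natAbs (t : ℕ) (ht : t ≤ d) :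
    overLen k pos t = (wsum k pos (Finset.univ.filter fun i : Fin d => (i : ℕ) < t)).natAbs := by
  rw [← streamLen_sub_streamLen k pos t ht, overLen]
  omega

/-- The *overhang* after `t` blocks: the part of the longer stream beyond the shorter one
(LST 2025, Lemma 22, the string `τ` kept by the vertex `v_τ`).
[cite: LimayeSrinivasanTavenas2025, Lemma 22] -/
def overhang (w : (i : Fin d) → BlockVar k pos i) (t : ℕ) : List Bool :=
  if streamLen k pos false t ≤ streamLen k pos true t then
    (stream k pos true w t).drop (streamLen k pos false t)
  else (stream k pos false w t).drop (streamLen k pos true t)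

/-- The overhang has length `overLen`. [cite: LimayeSrinivasanTavenas2025, Lemma 22] -/
@[simp]
theorem length_overhang (w : (i : Fin d) → BlockVar k pos i) (t : ℕ) :
    (overhang k pos w t).length = overLen k pos t := by
  unfold overhang overLen
  split_ifs with h <;> simp <;> omega

/-- The overhang in terms of the block's own sign: if the stream of sign `sgn` is at least as
long, the overhang is its tail beyond the other stream's length, otherwise the converse.
[cite: LimayeSrinivasanTavenas2025, Lemma 22] -/
theorem overhang_eq (sgn : Bool) (w : (i : Fin d) → BlockVar k pos i) (t : ℕ) :
    overhang k pos w t =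
      if streamLen k pos (!sgn) t ≤ streamLen k pos sgn t then
        (stream k pos sgn w t).drop (streamLen k pos (!sgn) t)
      else (stream k pos (!sgn) w t).drop (streamLen k pos sgn t) := by
  unfold overhang
  cases sgn
  · simp only [Bool.not_false]
    by_cases h1 : streamLen k pos false t ≤ streamLen k pos true t <;>
      by_cases h2 : streamLen k pos true t ≤ streamLen k pos false t
    · -- equal lengths: both overhangs are empty
      have heq : streamLen k pos true t = streamLen k pos false t := le_antisymm h2 h1
      rw [if_pos h1, if_pos h2]
      rw [List.drop_eq_nil_of_le (by simp [heq]), List.drop_eq_nil_of_le (by simp [heq])]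
    · rw [if_pos h1, if_neg h2]
    · rw [if_neg h1, if_pos h2]
    · omega
  · simp only [Bool.not_true]

end Streams

/-! ### The queue automaton (LST 2025, Lemma 22) -/

section Automaton

variable {d : ℕ} (k : ℕ) (pos : Fin d → Bool)

/-- A sign is never its own negation. [folklore] -/
theorem ne_not_self' (b : Bool) : b ≠ !b := by cases b <;> decide

/-- Overhang length after a *push* (block `t` on the longer-or-equal side):
`|w_{[t+1]}| = |w_{[t]}| + |w_t|`. [cite: LimayeSrinivasanTavenas2025, Lemma 22] -/
theorem overLen_succ_of_le (t : Fin d)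
    (hle : streamLen k pos (!pos t) t ≤ streamLen k pos (pos t) t) :
    overLen k pos (t.val + 1) = overLen k pos t + letterSize k pos t := by
  rw [overLen_eq k pos (pos t) t, overLen_eq k pos (pos t) (t.val + 1),
    streamLen_succ k pos _ t.2, streamLen_succ k pos _ t.2, if_pos rfl,
    if_neg (ne_not_self' (pos t))]
  simp only [Fin.eta, add_zero]
  omega

/-- Overhang length after a *compare* (block `t` on the shorter side):
`|w_{[t+1]}|` is the distance between `|w_{[t]}|` and `|w_t|`.
[cite: LimayeSrinivasanTavenas2025, Lemma 22] -/
theorem overLen_succ_of_lt (t : Fin d)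
    (hlt : streamLen k pos (pos t) t < streamLen k pos (!pos t) t) :
    overLen k pos (t.val + 1) = (overLen k pos t - letterSize k pos t) +
      (letterSize k pos t - overLen k pos t) := by
  rw [overLen_eq k pos (pos t) t, overLen_eq k pos (pos t) (t.val + 1),
    streamLen_succ k pos _ t.2, streamLen_succ k pos _ t.2, if_pos rfl,
    if_neg (ne_not_self' (pos t))]
  simp only [Fin.eta, add_zero]
  omega

/-- **The transition of the queue automaton** at layer `t` (LST 2025, proof of Lemma 22): the
state is the current overhang; reading the label `b` of block `t`,
* if block `t` lies on the longer (or equally long) side, push: the new overhang is `o ++ b`;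
* otherwise compare `b` with the oldest overhang bits: reject unless they are compatible, and
  the new overhang is what remains of `o` (if `|b| ≤ |o|`) or of `b` (if `|b| > |o|`).
[cite: LimayeSrinivasanTavenas2025, Lemma 22] -/
def wordStep (t : Fin d) (o : List.Vector Bool (overLen k pos t)) (b : BlockVar k pos t) :
    Option (List.Vector Bool (overLen k pos (t.val + 1))) :=
  if hle : streamLen k pos (!pos t) t ≤ streamLen k pos (pos t) t then
    some ⟨o.1 ++ List.ofFn b, by
      have ho : o.1.length = overLen k pos t := o.2
      rw [List.length_append, List.length_ofFn, overLen_succ_of_le k pos t hle]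
      omega⟩
  else if Compat (List.ofFn b) o.1 then
    some ⟨if letterSize k pos t ≤ overLen k pos t then o.1.drop (letterSize k pos t)
        else (List.ofFn b).drop (overLen k pos t), by
      have ho : o.1.length = overLen k pos t := o.2
      have hlen := overLen_succ_of_lt k pos t (not_le.1 hle)
      split_ifs with h
      · rw [List.length_drop]; omega
      · rw [List.length_drop, List.length_ofFn]; omega⟩
  else none

/-- The start state: the empty overhang. [cite: LimayeSrinivasanTavenas2025, Lemma 22] -/
def wordStart : List.Vector Bool (overLen k pos 0) := ⟨[], by simp [overLen, streamLen]⟩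

/-- **Correctness of the queue automaton** (LST 2025, Lemma 22: the vertex `v_τ` of layer `i`
collects exactly the monomials `m` over `X_1, …, X_i` with `σ(m⁺) = σ(m⁻) τ`, resp.
`σ(m⁻) τ = σ(m⁺)`): after `t ≤ d` blocks the run is defined iff the two streams are compatible,
and then the state is the overhang. [cite: LimayeSrinivasanTavenas2025, Lemma 22] -/
theorem run_wordStep (w : (i : Fin d) → BlockVar k pos i) (t : ℕ) (ht : t ≤ d) :
    LayeredAutomaton.run (St := fun t => List.Vector Bool (overLen k pos t))
        (wordStart k pos) (wordStep k pos) w t =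
      if Valid k pos w t then some ⟨overhang k pos w t, length_overhang k pos w t⟩ else none := by
  induction t with
  | zero =>
    have hv : Valid k pos w 0 := Or.inl List.prefix_rfl
    rw [if_pos hv]
    change some (wordStart k pos) = _
    congr 1
  | succ t ih =>
    have ht' : t < d := Nat.lt_of_succ_le ht
    rw [LayeredAutomaton.run_succ _ _ _ _ ht', ih ht'.le]
    by_cases hv : Valid k pos w t
    · rw [if_pos hv, Option.bind_some]
      -- notation: the block's own stream `p`, the other stream `q`, the label `bl`
      set sgn := pos ⟨t, ht'⟩ with hsgn
      have hp : stream k pos sgn w (t + 1) = stream k pos sgn w t ++ List.ofFn (w ⟨t, ht'⟩) := by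
        rw [stream_succ k pos sgn w ht', if_pos hsgn.symm]
      have hq : stream k pos (!sgn) w (t + 1) = stream k pos (!sgn) w t := by
        rw [stream_succ k pos (!sgn) w ht', if_neg (by rw [hsgn]; cases pos ⟨t, ht'⟩ <;> simp),
          List.append_nil]
      have hlenq : streamLen k pos (!sgn) (t + 1) = streamLen k pos (!sgn) t := by
        rw [streamLen_succ k pos _ ht', if_neg (by rw [hsgn]; cases pos ⟨t, ht'⟩ <;> simp),
          add_zero]
      have hlenp : streamLen k pos sgn (t + 1) =
          streamLen k pos sgn t + letterSize k pos ⟨t, ht'⟩ := by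
        rw [streamLen_succ k pos _ ht', if_pos hsgn.symm]
      have hvt : Compat (stream k pos sgn w t) (stream k pos (!sgn) w t) :=
        (valid_iff k pos sgn w t).1 hv
      have hval1 : Valid k pos w (t + 1) ↔
          Compat (stream k pos sgn w t ++ List.ofFn (w ⟨t, ht'⟩)) (stream k pos (!sgn) w t) := by
        rw [valid_iff k pos sgn, hp, hq]
      have hlen_sgn : (stream k pos sgn w t).length = streamLen k pos sgn t :=
        length_stream _ _ _ _ _
      have hlen_nsgn : (stream k pos (!sgn) w t).length = streamLen k pos (!sgn) t :=
        length_stream _ _ _ _ _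
      have hov_len : overLen k pos t = (streamLen k pos sgn t - streamLen k pos (!sgn) t) +
          (streamLen k pos (!sgn) t - streamLen k pos sgn t) := overLen_eq k pos sgn t
      unfold wordStep
      by_cases hle : streamLen k pos (!sgn) t ≤ streamLen k pos sgn t
      · -- push case
        rw [dif_pos hle]
        have hv1 : Valid k pos w (t + 1) := by
          rw [hval1, compat_append_iff_of_le (by rw [hlen_sgn, hlen_nsgn]; exact hle)]
          exact hvt
        rw [if_pos hv1, Option.some.injEq]
        apply Subtype.ext
        change overhang k pos w t ++ List.ofFn (w ⟨t, ht'⟩) = overhang k pos w (t + 1)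
        rw [overhang_eq k pos sgn w t, if_pos hle, overhang_eq k pos sgn w (t + 1), hlenq, hlenp,
          if_pos (by omega), hp, drop_append_of_le (by rw [hlen_sgn]; exact hle)]
      · -- compare case
        rw [dif_neg hle]
        have hlt : streamLen k pos sgn t < streamLen k pos (!sgn) t := not_le.1 hle
        have hov : overhang k pos w t = (stream k pos (!sgn) w t).drop (streamLen k pos sgn t) := by
          rw [overhang_eq k pos sgn w t, if_neg hle]
        have key := compat_append_iff_of_lt (p := stream k pos sgn w t)
          (q := stream k pos (!sgn) w t) (by rw [hlen_sgn, hlen_nsgn]; exact hlt) hvt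
          (List.ofFn (w ⟨t, ht'⟩))
        rw [hlen_sgn, ← hov] at key
        by_cases hc : Compat (List.ofFn (w ⟨t, ht'⟩)) (overhang k pos w t)
        · rw [if_pos hc]
          have hv1 : Valid k pos w (t + 1) := by rw [hval1, key]; exact hc
          rw [if_pos hv1, Option.some.injEq]
          apply Subtype.ext
          change (if letterSize k pos ⟨t, ht'⟩ ≤ overLen k pos t
              then (overhang k pos w t).drop (letterSize k pos ⟨t, ht'⟩)
              else (List.ofFn (w ⟨t, ht'⟩)).drop (overLen k pos t)) = overhang k pos w (t + 1)
          rw [overhang_eq k pos sgn w (t + 1), hlenq, hlenp, hp, hq]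
          by_cases hbo : letterSize k pos ⟨t, ht'⟩ ≤ overLen k pos t
          · rw [if_pos hbo, hov, List.drop_drop]
            by_cases hcase :
                streamLen k pos (!sgn) t ≤ streamLen k pos sgn t + letterSize k pos ⟨t, ht'⟩
            · -- boundary: both streams end at the same length, both overhangs are empty
              have heq : streamLen k pos (!sgn) t =
                  streamLen k pos sgn t + letterSize k pos ⟨t, ht'⟩ := by omega
              rw [if_pos hcase, List.drop_eq_nil_of_le (by rw [hlen_nsgn, heq]),
                List.drop_eq_nil_of_le (by simp [hlen_sgn, heq])]
            · rw [if_neg hcase]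
          · rw [if_neg hbo]
            have hcase : streamLen k pos (!sgn) t ≤
                streamLen k pos sgn t + letterSize k pos ⟨t, ht'⟩ := by omega
            rw [if_pos hcase, List.drop_append,
              List.drop_eq_nil_of_le (as := stream k pos sgn w t) (by rw [hlen_sgn]; omega),
              List.nil_append, hlen_sgn]
            congr 1
            omega
        · rw [if_neg hc]
          have hv1 : ¬ Valid k pos w (t + 1) := by rw [hval1, key]; exact hc
          rw [if_neg hv1]
    · rw [if_neg hv, Option.bind_none]
      have hv1 : ¬ Valid k pos w (t + 1) := by
        intro h1
        apply hv
        rw [valid_iff k pos (pos ⟨t, ht'⟩)] at h1 ⊢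
        rw [stream_succ k pos _ w ht', if_pos rfl, stream_succ k pos _ w ht',
          if_neg (by cases pos ⟨t, ht'⟩ <;> simp), List.append_nil] at h1
        exact h1.of_append_left
      rw [if_neg hv1]

/-- **Acceptance = compatibility of the full streams**: the queue automaton accepts exactly
the assignments whose monomial belongs to `P_w` (LST 2025, Lemma 22).
[cite: LimayeSrinivasanTavenas2025, Lemma 22] -/
theorem accepts_wordStep_iff (w : (i : Fin d) → BlockVar k pos i) :
    LayeredAutomaton.Accepts (St := fun t => List.Vector Bool (overLen k pos t))
        (wordStart k pos) (wordStep k pos) w ↔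
      Compat (stream k pos true w d) (stream k pos false w d) := by
  unfold LayeredAutomaton.Accepts
  rw [run_wordStep k pos w d le_rfl]
  change _ ↔ Valid k pos w d
  split_ifs with h <;> simp [h]

end Automaton

/-! ### The word polynomial and the substitution -/

section WordPoly

variable {d : ℕ} (k : ℕ) (pos : Fin d → Bool) (K : Type*) [CommSemiring K]

/-- **The word polynomial `P_w`** (LST 2025, §2.2, p. 26:9): the sum of the set-multilinear
monomials `m` over `X(w)` with `σ(m⁺) ∼ σ(m⁻)`. [cite: LimayeSrinivasanTavenas2025, §2.2] -/
def wordPoly : MvPolynomial (Σ i : Fin d, BlockVar k pos i) K :=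
  ∑ w : (i : Fin d) → BlockVar k pos i,
    if Compat (stream k pos true w d) (stream k pos false w d) then ∏ i : Fin d, X ⟨i, w i⟩ else 0

variable {n : ℕ} (hn : ∀ t ≤ d, 2 ^ overLen k pos t ≤ n)

/-- Encoding a bit-string of length `L` as an element of `Fin (2^L)`. [folklore] -/
def bitsEquivFin (L : ℕ) : List.Vector Bool L ≃ Fin (2 ^ L) :=
  (Equiv.vectorEquivFin Bool L).trans
    ((Equiv.arrowCongr (Equiv.refl (Fin L)) finTwoEquiv.symm).trans finFunctionFinEquiv)

/-- **The state encodings**: the overhangs of layer `t` (bit-strings of length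
`|w_{[t]}| ≤ k`) embed into `Fin n` as soon as `2^{|w_{[t]}|} ≤ n` (LST 2025, Lemma 22: width
`2^b`). [cite: LimayeSrinivasanTavenas2025, Lemma 22] -/
def wordEnc (t : ℕ) (o : List.Vector Bool (overLen k pos t)) : Fin n :=
  if h : t ≤ d then Fin.castLE (hn t h) (bitsEquivFin _ o) else ⟨0, by
    have := hn 0 (Nat.zero_le d); have h1 : 1 ≤ 2 ^ overLen k pos 0 := Nat.one_le_two_pow; omega⟩

/-- The state encodings are injective on every layer `t ≤ d`.
[cite: LimayeSrinivasanTavenas2025, Lemma 22] -/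
theorem wordEnc_injective (t : ℕ) (ht : t ≤ d) : Function.Injective (wordEnc k pos hn t) := by
  intro o o' h
  unfold wordEnc at h
  rw [dif_pos ht, dif_pos ht] at h
  exact (bitsEquivFin _).injective (Fin.castLE_injective _ h)

/-- **The substitution `ρ`** turning `IMM_{n,d}` into `P_w` (LST 2025, proof of Lemma 8): the
`IMM` variable `x^{(t)}_{e,e'}` goes to the sum of the labels of block `t` that move the queue
automaton from the overhang encoded by `e` to the overhang encoded by `e'`.
[cite: LimayeSrinivasanTavenas2025, Lemma 8] -/
def wordSubst : Fin d × Fin n × Fin n → MvPolynomial (Σ i : Fin d, BlockVar k pos i) K :=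
  LayeredAutomaton.autSubst (St := fun t => List.Vector Bool (overLen k pos t))
    (wordStart k pos) (wordStep k pos) (wordEnc k pos hn)

/-- **`P_w` is a projection of `IMM_{n,d}`** (LST 2025, Lemma 8 / Lemma 22): for `0 < d` and
`n ≥ 2^{|w_{[t]}|}` for all `t`, `aeval (wordSubst) (immPoly n d K) = wordPoly`.
[cite: LimayeSrinivasanTavenas2025, Lemma 8] -/
theorem aeval_wordSubst_immPoly (hd : 0 < d) :
    aeval (wordSubst k pos K hn) (immPoly n d K) = wordPoly k pos K := by
  unfold wordSubst wordPoly
  rw [LayeredAutomaton.aeval_autSubst_immPoly _ _ _ (wordEnc_injective k pos hn) hd]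
  refine Finset.sum_congr rfl fun w _ => ?_
  simp only [accepts_wordStep_iff]

/-- **The substitution is block-preserving**: each `IMM` variable of layer `t` goes to a linear
form in the variables of block `t` (LST 2025, proof of Lemma 8: "set-multilinear restriction").
[cite: LimayeSrinivasanTavenas2025, Lemma 8] -/
theorem isBlockPreserving_wordSubst :
    IsBlockPreserving (Prod.fst : Fin d × Fin n × Fin n → Fin d)
      (Sigma.fst : (Σ i : Fin d, BlockVar k pos i) → Fin d) (wordSubst k pos K hn) := by
  intro v
  unfold wordSubst LayeredAutomaton.autSubst
  refine IsWeightedHomogeneous.sum _ _ _ fun b _ => ?_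
  split_ifs
  · exact isWeightedHomogeneous_X K _ _
  · exact isWeightedHomogeneous_zero K _ _

end WordPoly

end LSTWord

end Literature.Computability.AlgebraicComplexity
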